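import Mathlib
import Summits.PneNP.PneNP.Theorems.OverlapGapAlgebraSearchHardWindowThresholdTails
import Summits.PneNP.PneNP.Theorems.OverlapGapAlgebraSearchHardWindowVanishingRobustSign

/-!
# Route OverlapGapAlgebra, crux `SearchHardWindow` (stmt-PneNP-2460): the robust class rung in
# SLOT vocabulary — Boolean output maps with small Efron–Stein tails on the literal-slot space fail

The slot-space analogue of `shwF_robustClassRung` (`…RobustClassRung.lean`, which is stated for
Boolean functions of the `m k (j+1)` instance BITS with `n = 2^j` and cube-Fourier tails). Here the
output maps are Boolean functions on the product space of literal slots,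
`(Fin m × Fin k → Fin n × Bool) → Bool` (alphabet = the `2n` literals, ANY `n`), and the tail of
`G = (±1)^g` above level `D` is measured by the distance to its Hoeffding truncation,
`Σ_y (G y − Σ_{|S|<D} G^{=S} y)² = Σ_{|S| ≥ D} ‖G^{=S}‖²` (`Literature.Probability.Moments`).

**Theorem (`slotRobustClassRung`).** There is `k₀` such that for all `k ≥ k₀` and every family of
classes `𝒢 n m` of such maps with the property
  "for every `τ > 0` there is a level `D_τ(n) = o(n / log² n)` such that eventually in `n`, for all
   `m` and all `g ∈ 𝒢 n m`, `Σ_{|S| ≥ D_τ(n)} ‖G^{=S}‖² ≤ τ · #points`",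
for every `ε > 0`, eventually in `n`, with `m = ⌊5 · 2^k log k / k · n⌋`: every family
`g : Fin n → 𝒢 n m` (one output map per variable) outputs a satisfying assignment of
`Φ ∼ F_k(n, m)` for at most `ε · #instances` instances.

Proof: that of `thresholdStatisticRung` (`…ThresholdRung.lean`) with the class hypothesis in place
of Peres's theorem — truncate at `D_τ(n)`, `τ = ε η₀ / 8`; the surrogate `2 · T_{<D}` has coordinate
degree `≤ D`, energy `≤ 4 n #Inst` (`shwT_truncation_energy_le`, `shwT_truncation_isCoordDegreeLE`)
and is saturated with the right sign outside `≤ 4 τ #Inst` inputs per coordinate; Markov over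
inputs and `vanishingLowDegreeRobustSign`. Instances: additive-threshold statistics
(`thresholdStatisticRung`, constant level), depth-two threshold circuits
(`…ThresholdCircuitRung.lean`). No new definitions; axioms standard.

References: O'Donnell 2014 §3.1, §8.3 [ODonnell2014]; Bresler–Huang arXiv:2106.02129 Thm. 2.6
[BreslerHuang2022]; Huang–Sellke arXiv:2501.06427 Cor. 3.21 [HuangSellke2025].
-/

set_option linter.dupNamespace false -- `Summit.PneNP.PneNP.…`: summit = sub-problem (D-0017)

noncomputable section

namespace Summit.PneNP.PneNP.Theorems

open Finset Filter Asymptotics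
open Literature.Computability.Complexity (IsCoordDegreeLE)
open Literature.Probability.Moments
open scoped Classical

/-- **The robust class rung in slot vocabulary (unconditional).** See the module docstring.
[cite: BreslerHuang2022, Thm. 2.6] -/
theorem slotRobustClassRung :
    ∃ k₀ : ℕ, ∀ k : ℕ, k₀ ≤ k →
      ∀ (𝒢 : (n m : ℕ) → ((Fin m × Fin k → Fin n × Bool) → Bool) → Prop),
      (∀ τ : ℝ, 0 < τ → ∃ D : ℕ → ℕ,
        (fun n : ℕ => (D n : ℝ)) =o[atTop] (fun n : ℕ => (n : ℝ) / Real.log n ^ 2) ∧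
        ∀ᶠ n : ℕ in atTop, ∀ (m : ℕ) (g : (Fin m × Fin k → Fin n × Bool) → Bool), 𝒢 n m g →
          ∑ y : Fin m × Fin k → Fin n × Bool, ((if g y then (1 : ℝ) else -1) -
            ∑ S ∈ (univ : Finset (Fin m × Fin k)).powerset.filter (fun S => S.card < D n),
              hoeffdingComp S (fun y => if g y then (1 : ℝ) else -1) y) ^ 2
            ≤ τ * Fintype.card (Fin m × Fin k → Fin n × Bool)) →
      ∀ ε : ℝ, 0 < ε →
      ∀ᶠ n : ℕ in atTop, ∀ m : ℕ, m = ⌊5 * 2 ^ k * Real.log k / k * n⌋₊ →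
        ∀ g : Fin n → (Fin m → Fin k → Fin n × Bool) → Bool,
          (∀ v : Fin n, 𝒢 n m (fun y => g v (Function.curry y))) →
          ((univ.filter fun Φ : Fin m → Fin k → Fin n × Bool =>
              ∀ i : Fin m, ∃ j : Fin k, g (Φ i j).1 Φ = (Φ i j).2).card : ℝ)
            ≤ ε * Fintype.card (Fin m → Fin k → Fin n × Bool) := by
  obtain ⟨k₀, hk₀⟩ := vanishingLowDegreeRobustSign
  refine ⟨k₀, fun k hk 𝒢 hclass ε hε => ?_⟩
  obtain ⟨η₀, hη₀, hR⟩ := hk₀ k hk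
  -- the tail level `τ = ε η₀ / 8` and its degree sequence
  set τ : ℝ := ε * η₀ / 8 with hτ
  have hτpos : 0 < τ := by positivity
  obtain ⟨D, hDo, htail⟩ := hclass τ hτpos
  have hev := hR 4 (by norm_num) D hDo (ε / 2) (half_pos hε)
  filter_upwards [hev, htail, eventually_ge_atTop 1] with n hRn htailn hn1
  intro m hm g hOK
  haveI : Nonempty (Fin n × Bool) := ⟨(⟨0, hn1⟩, true)⟩
  have hnpos : (0 : ℝ) < n := by exact_mod_cast hn1
  -- truncations and the surrogate `F Φ v = 2 T_{<D n}[(±1)^{g v}] (Φ)`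
  set Tr : Fin n → (Fin m × Fin k → Fin n × Bool) → ℝ := fun v y =>
    ∑ S ∈ (univ : Finset (Fin m × Fin k)).powerset.filter (fun S => S.card < D n),
      hoeffdingComp S (fun y => if g v (Function.curry y) then (1 : ℝ) else -1) y with hTr
  set F : (Fin m → Fin k → Fin n × Bool) → Fin n → ℝ := fun Φ v =>
    2 * Tr v (Function.uncurry Φ) with hF
  -- (i) coordinate degree `≤ D n`
  have hdeg : ∀ v : Fin n, IsCoordDegreeLE (D n)
      (fun y : Fin m × Fin k → Fin n × Bool => F (Function.curry y) v) := by
    intro v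
    have h := (shwT_truncation_isCoordDegreeLE
      (fun y : Fin m × Fin k → Fin n × Bool => if g v (Function.curry y) then (1 : ℝ) else -1)
      (D n)).smul 2
    have he : (fun y : Fin m × Fin k → Fin n × Bool => F (Function.curry y) v) =
        fun y => 2 * Tr v y := by
      funext y; simp only [hF, Function.uncurry_curry]
    rw [he]
    exact h
  -- (ii) energy `≤ 4 n #Inst`
  have hcardEq : (Fintype.card (Fin m × Fin k → Fin n × Bool) : ℝ) =
      Fintype.card (Fin m → Fin k → Fin n × Bool) := by
    rw [Fintype.card_congr (Equiv.curry (Fin m) (Fin k) (Fin n × Bool))]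
  have henergy : ∑ Φ : Fin m → Fin k → Fin n × Bool, ∑ v : Fin n, F Φ v ^ 2
      ≤ 4 * n * Fintype.card (Fin m → Fin k → Fin n × Bool) := by
    have hG : ∑ Φ : Fin m → Fin k → Fin n × Bool, ∑ v, F Φ v ^ 2 =
        ∑ y : Fin m × Fin k → Fin n × Bool, ∑ v, (2 * Tr v y) ^ 2 :=
      Fintype.sum_equiv (Equiv.curry (Fin m) (Fin k) (Fin n × Bool)).symm _ _ fun Φ => rfl
    rw [hG, Finset.sum_comm, ← hcardEq]
    calc ∑ v : Fin n, ∑ y : Fin m × Fin k → Fin n × Bool, (2 * Tr v y) ^ 2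
        ≤ ∑ _v : Fin n, 4 * (Fintype.card (Fin m × Fin k → Fin n × Bool) : ℝ) := by
          refine Finset.sum_le_sum fun v _ => ?_
          have := shwT_truncation_energy_le
            (fun y : Fin m × Fin k → Fin n × Bool => g v (Function.curry y)) (D n)
          simp only [hTr]
          calc ∑ y : Fin m × Fin k → Fin n × Bool, (2 * ∑ S ∈ (univ : Finset (Fin m × Fin k)).powerset.filter
                (fun S => S.card < D n), hoeffdingComp S
                  (fun y => if g v (Function.curry y) then (1 : ℝ) else -1) y) ^ 2
              = 4 * ∑ y : Fin m × Fin k → Fin n × Bool, (∑ S ∈ (univ : Finset (Fin m × Fin k)).powerset.filter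
                (fun S => S.card < D n), hoeffdingComp S
                  (fun y => if g v (Function.curry y) then (1 : ℝ) else -1) y) ^ 2 := by
                rw [mul_sum]; exact sum_congr rfl fun y _ => by ring
            _ ≤ _ := by linarith
      _ = 4 * n * (Fintype.card (Fin m × Fin k → Fin n × Bool) : ℝ) := by
          rw [Finset.sum_const, Finset.card_univ, Fintype.card_fin, nsmul_eq_mul]
          ring
  -- (iii) the sign-robust low-degree bound for `F`
  have hRF := hRn m hm F hdeg henergy
  -- (iv) bad (input, coordinate) pairs: few per coordinate, by the class hypothesis
  set bad : (Fin m → Fin k → Fin n × Bool) → Fin n → Prop := fun Φ v =>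
    ¬ (1 ≤ |F Φ v| ∧ decide (0 ≤ F Φ v) = g v Φ) with hbad
  have hbad_v : ∀ v : Fin n, ((univ.filter fun Φ : Fin m → Fin k → Fin n × Bool => bad Φ v).card : ℝ)
      ≤ 4 * τ * Fintype.card (Fin m → Fin k → Fin n × Bool) := by
    intro v
    have hdist := htailn m (fun y : Fin m × Fin k → Fin n × Bool => g v (Function.curry y)) (hOK v)
    rw [← hcardEq]
    -- pointwise: a bad input is `1/2`-far from its truncation
    have hpt : ∀ y : Fin m × Fin k → Fin n × Bool,
        (if bad (Function.curry y) v then (1 : ℝ) else 0) ≤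
          4 * ((if g v (Function.curry y) then (1 : ℝ) else -1) - Tr v y) ^ 2 := by
      intro y
      by_cases hb : bad (Function.curry y) v
      · rw [if_pos hb]
        by_contra hlt
        push Not at hlt
        apply hb
        have hFy : F (Function.curry y) v = 2 * Tr v y := by
          simp only [hF, Function.uncurry_curry]
        rw [hFy]
        cases hgv : g v (Function.curry y)
        · rw [hgv] at hlt
          simp only [Bool.false_eq_true, if_false] at hlt
          have h1 : Tr v y < -1 / 2 := by nlinarith
          refine ⟨?_, ?_⟩
          · rw [abs_of_neg (by linarith)]; linarith
          · simp only [decide_eq_false_iff_not, not_le]; linarith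
        · rw [hgv] at hlt
          simp only [if_true] at hlt
          have h1 : 1 / 2 < Tr v y := by nlinarith
          refine ⟨?_, ?_⟩
          · rw [abs_of_pos (by linarith)]; linarith
          · simp only [decide_eq_true_eq]; linarith
      · rw [if_neg hb]; positivity
    calc ((univ.filter fun Φ : Fin m → Fin k → Fin n × Bool => bad Φ v).card : ℝ)
        = ∑ y : Fin m × Fin k → Fin n × Bool, (if bad (Function.curry y) v then (1 : ℝ) else 0) := by
          rw [card_eq_sum_ones, Nat.cast_sum, sum_filter]
          push_cast
          exact (Fintype.sum_equiv (Equiv.curry (Fin m) (Fin k) (Fin n × Bool)) _ _ fun y => rfl).symm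
      _ ≤ ∑ y : Fin m × Fin k → Fin n × Bool,
          4 * ((if g v (Function.curry y) then (1 : ℝ) else -1) - Tr v y) ^ 2 := sum_le_sum fun y _ => hpt y
      _ ≤ 4 * (τ * Fintype.card (Fin m × Fin k → Fin n × Bool)) := by
          rw [← mul_sum]
          exact mul_le_mul_of_nonneg_left hdist (by norm_num)
      _ = 4 * τ * Fintype.card (Fin m × Fin k → Fin n × Bool) := by ring
  -- (v) Markov: few inputs have more than `η₀ n` bad coordinates
  have hbadsum : ∑ Φ : Fin m → Fin k → Fin n × Bool,
      ((univ.filter fun v : Fin n => bad Φ v).card : ℝ) ≤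
      n * (4 * τ * Fintype.card (Fin m → Fin k → Fin n × Bool)) := by
    rw [shwF_sum_card_filter_comm]
    calc ∑ v : Fin n, ((univ.filter fun Φ : Fin m → Fin k → Fin n × Bool => bad Φ v).card : ℝ)
        ≤ ∑ _v : Fin n, 4 * τ * Fintype.card (Fin m → Fin k → Fin n × Bool) :=
          sum_le_sum fun v _ => hbad_v v
      _ = _ := by rw [sum_const, card_univ, Fintype.card_fin, nsmul_eq_mul]
  have hη₀n : 0 < η₀ * (n : ℝ) := by positivity
  have hBx : ((univ.filter fun Φ : Fin m → Fin k → Fin n × Bool =>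
      η₀ * (n : ℝ) < ((univ.filter fun v : Fin n => bad Φ v).card : ℝ)).card : ℝ) ≤
      ε / 2 * Fintype.card (Fin m → Fin k → Fin n × Bool) := by
    have h1 := (shwF_card_filter_lt_card_le bad (η₀ * (n : ℝ))).trans hbadsum
    refine le_of_mul_le_mul_left (h1.trans (le_of_eq ?_)) hη₀n
    rw [hτ]
    ring
  -- (vi) solved inputs with few bad coordinates lie in the robust event
  have hgood : ((univ.filter fun Φ : Fin m → Fin k → Fin n × Bool =>
      (∀ i : Fin m, ∃ j : Fin k, g (Φ i j).1 Φ = (Φ i j).2) ∧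
      ¬ η₀ * (n : ℝ) < ((univ.filter fun v : Fin n => bad Φ v).card : ℝ)).card : ℝ) ≤
      ε / 2 * Fintype.card (Fin m → Fin k → Fin n × Bool) := by
    refine le_trans ?_ hRF
    refine Nat.cast_le.2 (Finset.card_le_card fun Φ hΦ => ?_)
    simp only [mem_filter, mem_univ, true_and] at hΦ ⊢
    obtain ⟨hsol, hfew⟩ := hΦ
    rw [not_lt] at hfew
    refine ⟨fun v => g v Φ, hsol, le_trans ?_ hfew⟩
    refine Nat.cast_le.2 (Finset.card_le_card fun v hv => ?_)
    simp only [Finset.mem_filter, Finset.mem_univ, true_and, hbad] at hv ⊢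
    rintro ⟨h1, h2⟩
    rcases hv with hv | hv
    · exact absurd h1 (not_le.2 hv)
    · exact hv h2.symm
  -- (vii) conclusion
  have hsplit := shwRung_card_filter_le_and_add_not
    (fun Φ : Fin m → Fin k → Fin n × Bool => ∀ i : Fin m, ∃ j : Fin k, g (Φ i j).1 Φ = (Φ i j).2)
    (fun Φ => ¬ η₀ * (n : ℝ) < ((univ.filter fun v : Fin n => bad Φ v).card : ℝ))
  have hsplit' := (Nat.cast_le (α := ℝ)).2 hsplit
  rw [Nat.cast_add] at hsplit'
  have hBx' : ((univ.filter fun Φ : Fin m → Fin k → Fin n × Bool =>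
      ¬ ¬ η₀ * (n : ℝ) < ((univ.filter fun v : Fin n => bad Φ v).card : ℝ)).card : ℝ) ≤
      ε / 2 * Fintype.card (Fin m → Fin k → Fin n × Bool) := by
    simp only [not_not]
    exact hBx
  linarith [hsplit', hgood, hBx']

end Summit.PneNP.PneNP.Theorems

end
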